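import Summits.BirchSwinnertonDyer.Rank1Residual.Additive.X3ThreeLineDatum
import Summits.BirchSwinnertonDyer.Rank1Residual.X2.CellAGVParCertificatesN9A
import Mathlib.Tactic.Simproc.Factors
import HarnessLib

/-!
# X3♯(G-ord, `e = 2`) at `p = 3`: kernel records of the per-pair LINE DATUM `X3LineDatumThree W` for the
# Case-1 members of the B-X3G booking list — part N of 16 (cell `bsd-addord`, seat
# `bsd-addord-twist`, strategy = twist transport)

HONEST FRAMING (cell `bsd-addord`, `run/shared/lean/pub/bsd-addord/README.md` §4): the programme's
target of record is the full Birch–Swinnerton-Dyer formula for every `E/ℚ` of analytic rank `≤ 1`.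
DATA-RECORDS module: theorems only (no definition, no named fact, no `sorry`); it BOOKS NOTHING and
moves no mark — booking is the planner's act (TARGET.md v5.5 §8 protocol B-X3G, (iv)).

## What is recorded

For each isogeny class `(N, class, 3)` of the booking list `HOME/bsd-addord-twist-booking-members.tsv`
(kit job j242057; the r_an = 0, non-CM, non-degenerate branch-parity classes of cell (G-ord, `e = 2`) at
`p = 3` in census v2, planner keys `HOME/planner/bx3g/`), the CASE-1 MEMBER `W = [a₁, a₂, a₃, a₄, a₆]`
(Cremona's globally minimal model; the first member in Cremona order carrying the EVEN rational `3`-line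
as a SUB-line) and the theorem `X3LineDatumThree W` — SOME rational `3`-line `Φ₀ ≤ W[3]` which is even,
has non-trivial `Γ_ℚ`-action and `χ_{−3}`-twist ramified at `3` — proved by
`x3LineDatumThree_of_cert_of_delta` from the certificate `(x₀, s, D, q)`: `Ψ₃(x₀) = 0`, `D` squarefree,
`s ≠ 0`, `D·s² = Ψ₂Sq(x₀)`, `0 < D`, `D ≠ 1`, `3 ∤ D` (`norm_num` identities, one prime-factor-list
computation with X2a's helper `squarefree_of_nodup_primeFactorsList_natAbs`, `decide`s). This is the per-pair line-datum input of
`ClassX3Gord.{{missingLowerBoundAt,bsdp}}_three_rankZero_of_facts_of_nonAnomalous`; the class binders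
(`ClassX3Gord W 3`, `¬ HasCM`, `analyticRank = 0`, `ReductionNonAnomalous W 3`) are data of record
(Cremona / the planner's two-engine census), NOT kernel statements here; the other members of each class
are reached by Cassels (`N10.bsdp_of_isIsogenous_of_bsdp`, binder `bsdRHS_eq_of_isIsogenous`). The
docstring of each record names the class, the anomalous bit of the twist `V = W ⊗ χ_{−3}` and `D`
(`φ = χ_D`). Records sorted by conductor.

References: [GreenbergVatsal2000] §2 p. 28 (the line `Φ`); lane file
`HOME/bsd-addord-twist-booking-members.tsv`; `Additive/X3ThreeLineDatum.lean`.
-/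

set_option autoImplicit false

open WeierstrassCurve Polynomial Literature.NumberTheory.EllipticCurves
  Literature.NumberTheory.EllipticCurves.Rank1Residual

namespace Summit.BirchSwinnertonDyer.Rank1Residual.Additive.X3ThreeLineDatumRecords

/-- `400752dh2` = `[0,0,0,-19965,1327007]` (class `400752dh`, (G-ord, `e = 2`) at `3`; twist `44528r2`, `a₃(V) = -1`, non-anomalous; even line
`φ = χ_{11}`): `x₀ = 33`, `D = 11`, `s = 506`, `Ψ₂Sq(x₀) = 2816396` ⇒ `X3LineDatumThree W`. [folklore] -/
theorem x3LineDatumThree_400752dh2 : X3LineDatumThree (⟨0, 0, 0, -19965, 1327007⟩ : WeierstrassCurve ℚ) :=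
  x3LineDatumThree_of_cert_of_delta _ (by norm_num [Δ, b₂, b₄, b₆, b₈]) 33 506 11
    (by simp only [Ψ₃, eval_add, eval_mul, eval_pow, eval_C, eval_X, eval_ofNat]; norm_num [b₂, b₄, b₆, b₈])
    (X2.CellACertN9.squarefree_of_nodup_primeFactorsList_natAbs (by norm_num) (by simp [Nat.primeFactorsList_ofNat])) (by norm_num)
    (by rw [KernelDisc.eval_Ψ₂Sq]; norm_num [b₂, b₄, b₆]) (by decide) (by decide) (by decide)

/-- `400752x2` = `[0,0,0,-6908979,6988929266]` (class `400752x`, (G-ord, `e = 2`) at `3`; twist `44528y2`, `a₃(V) = 2`, non-anomalous; even line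
`φ = χ_{11}`): `x₀ = 1617`, `D = 11`, `s = 4048`, `Ψ₂Sq(x₀) = 180249344` ⇒ `X3LineDatumThree W`. [folklore] -/
theorem x3LineDatumThree_400752x2 : X3LineDatumThree (⟨0, 0, 0, -6908979, 6988929266⟩ : WeierstrassCurve ℚ) :=
  x3LineDatumThree_of_cert_of_delta _ (by norm_num [Δ, b₂, b₄, b₆, b₈]) 1617 4048 11
    (by simp only [Ψ₃, eval_add, eval_mul, eval_pow, eval_C, eval_X, eval_ofNat]; norm_num [b₂, b₄, b₆, b₈])
    (X2.CellACertN9.squarefree_of_nodup_primeFactorsList_natAbs (by norm_num) (by simp [Nat.primeFactorsList_ofNat])) (by norm_num)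
    (by rw [KernelDisc.eval_Ψ₂Sq]; norm_num [b₂, b₄, b₆]) (by decide) (by decide) (by decide)

/-- `404586bc2` = `[1,-1,0,11718513,45513475749]` (class `404586bc`, (G-ord, `e = 2`) at `3`; twist `44954n2`, `a₃(V) = 1` — ANOMALOUS (outside the end state as typed); even line
`φ = χ_{13}`): `x₀ = 244`, `D = 13`, `s = 122018`, `Ψ₂Sq(x₀) = 193549100212` ⇒ `X3LineDatumThree W`. [folklore] -/
theorem x3LineDatumThree_404586bc2 : X3LineDatumThree (⟨1, -1, 0, 11718513, 45513475749⟩ : WeierstrassCurve ℚ) :=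
  x3LineDatumThree_of_cert_of_delta _ (by norm_num [Δ, b₂, b₄, b₆, b₈]) 244 122018 13
    (by simp only [Ψ₃, eval_add, eval_mul, eval_pow, eval_C, eval_X, eval_ofNat]; norm_num [b₂, b₄, b₆, b₈])
    (X2.CellACertN9.squarefree_of_nodup_primeFactorsList_natAbs (by norm_num) (by simp [Nat.primeFactorsList_ofNat])) (by norm_num)
    (by rw [KernelDisc.eval_Ψ₂Sq]; norm_num [b₂, b₄, b₆]) (by decide) (by decide) (by decide)

/-- `404928cj2` = `[0,0,0,660660,20246384]` (class `404928cj`, (G-ord, `e = 2`) at `3`; twist `44992e2`, `a₃(V) = -1`, non-anomalous; even line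
`φ = χ_{2}`): `x₀ = 294`, `D = 2`, `s = 21904`, `Ψ₂Sq(x₀) = 959570432` ⇒ `X3LineDatumThree W`. [folklore] -/
theorem x3LineDatumThree_404928cj2 : X3LineDatumThree (⟨0, 0, 0, 660660, 20246384⟩ : WeierstrassCurve ℚ) :=
  x3LineDatumThree_of_cert_of_delta _ (by norm_num [Δ, b₂, b₄, b₆, b₈]) 294 21904 2
    (by simp only [Ψ₃, eval_add, eval_mul, eval_pow, eval_C, eval_X, eval_ofNat]; norm_num [b₂, b₄, b₆, b₈])
    Int.prime_two.squarefree (by norm_num)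
    (by rw [KernelDisc.eval_Ψ₂Sq]; norm_num [b₂, b₄, b₆]) (by decide) (by decide) (by decide)

/-- `405900ba2` = `[0,0,0,-197400,33762125]` (class `405900ba`, (G-ord, `e = 2`) at `3`; twist `45100b2`, `a₃(V) = 2`, non-anomalous; even line
`φ = χ_{5}`): `x₀ = 240`, `D = 5`, `s = 410`, `Ψ₂Sq(x₀) = 840500` ⇒ `X3LineDatumThree W`. [folklore] -/
theorem x3LineDatumThree_405900ba2 : X3LineDatumThree (⟨0, 0, 0, -197400, 33762125⟩ : WeierstrassCurve ℚ) :=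
  x3LineDatumThree_of_cert_of_delta _ (by norm_num [Δ, b₂, b₄, b₆, b₈]) 240 410 5
    (by simp only [Ψ₃, eval_add, eval_mul, eval_pow, eval_C, eval_X, eval_ofNat]; norm_num [b₂, b₄, b₆, b₈])
    (X2.CellACertN9.squarefree_of_nodup_primeFactorsList_natAbs (by norm_num) (by simp [Nat.primeFactorsList_ofNat])) (by norm_num)
    (by rw [KernelDisc.eval_Ψ₂Sq]; norm_num [b₂, b₄, b₆]) (by decide) (by decide) (by decide)

/-- `408150l2` = `[1,-1,0,-29947167,63086041741]` (class `408150l`, (G-ord, `e = 2`) at `3`; twist `45350l2`, `a₃(V) = 2`, non-anomalous; even line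
`φ = χ_{5}`): `x₀ = 3154`, `D = 5`, `s = 500`, `Ψ₂Sq(x₀) = 1250000` ⇒ `X3LineDatumThree W`. [folklore] -/
theorem x3LineDatumThree_408150l2 : X3LineDatumThree (⟨1, -1, 0, -29947167, 63086041741⟩ : WeierstrassCurve ℚ) :=
  x3LineDatumThree_of_cert_of_delta _ (by norm_num [Δ, b₂, b₄, b₆, b₈]) 3154 500 5
    (by simp only [Ψ₃, eval_add, eval_mul, eval_pow, eval_C, eval_X, eval_ofNat]; norm_num [b₂, b₄, b₆, b₈])
    (X2.CellACertN9.squarefree_of_nodup_primeFactorsList_natAbs (by norm_num) (by simp [Nat.primeFactorsList_ofNat])) (by norm_num)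
    (by rw [KernelDisc.eval_Ψ₂Sq]; norm_num [b₂, b₄, b₆]) (by decide) (by decide) (by decide)

/-- `409950i2` = `[1,-1,0,-3527622,2551064116]` (class `409950i`, (G-ord, `e = 2`) at `3`; twist `45550f2`, `a₃(V) = 2`, non-anomalous; even line
`φ = χ_{5}`): `x₀ = 1084`, `D = 5`, `s = 32`, `Ψ₂Sq(x₀) = 5120` ⇒ `X3LineDatumThree W`. [folklore] -/
theorem x3LineDatumThree_409950i2 : X3LineDatumThree (⟨1, -1, 0, -3527622, 2551064116⟩ : WeierstrassCurve ℚ) :=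
  x3LineDatumThree_of_cert_of_delta _ (by norm_num [Δ, b₂, b₄, b₆, b₈]) 1084 32 5
    (by simp only [Ψ₃, eval_add, eval_mul, eval_pow, eval_C, eval_X, eval_ofNat]; norm_num [b₂, b₄, b₆, b₈])
    (X2.CellACertN9.squarefree_of_nodup_primeFactorsList_natAbs (by norm_num) (by simp [Nat.primeFactorsList_ofNat])) (by norm_num)
    (by rw [KernelDisc.eval_Ψ₂Sq]; norm_num [b₂, b₄, b₆]) (by decide) (by decide) (by decide)

/-- `410688cq3` = `[0,0,0,-10817580,-2895150544]` (class `410688cq`, (G-ord, `e = 2`) at `3`; twist `45632d3`, `a₃(V) = 2`, non-anomalous; even line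
`φ = χ_{2}`): `x₀ = 5046`, `D = 2`, `s = 376832`, `Ψ₂Sq(x₀) = 284004712448` ⇒ `X3LineDatumThree W`. [folklore] -/
theorem x3LineDatumThree_410688cq3 : X3LineDatumThree (⟨0, 0, 0, -10817580, -2895150544⟩ : WeierstrassCurve ℚ) :=
  x3LineDatumThree_of_cert_of_delta _ (by norm_num [Δ, b₂, b₄, b₆, b₈]) 5046 376832 2
    (by simp only [Ψ₃, eval_add, eval_mul, eval_pow, eval_C, eval_X, eval_ofNat]; norm_num [b₂, b₄, b₆, b₈])
    Int.prime_two.squarefree (by norm_num)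
    (by rw [KernelDisc.eval_Ψ₂Sq]; norm_num [b₂, b₄, b₆]) (by decide) (by decide) (by decide)

/-- `410688dj2` = `[0,0,0,-19740,-3340816]` (class `410688dj`, (G-ord, `e = 2`) at `3`; twist `45632b2`, `a₃(V) = -1`, non-anomalous; even line
`φ = χ_{2}`): `x₀ = 294`, `D = 2`, `s = 5704`, `Ψ₂Sq(x₀) = 65071232` ⇒ `X3LineDatumThree W`. [folklore] -/
theorem x3LineDatumThree_410688dj2 : X3LineDatumThree (⟨0, 0, 0, -19740, -3340816⟩ : WeierstrassCurve ℚ) :=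
  x3LineDatumThree_of_cert_of_delta _ (by norm_num [Δ, b₂, b₄, b₆, b₈]) 294 5704 2
    (by simp only [Ψ₃, eval_add, eval_mul, eval_pow, eval_C, eval_X, eval_ofNat]; norm_num [b₂, b₄, b₆, b₈])
    Int.prime_two.squarefree (by norm_num)
    (by rw [KernelDisc.eval_Ψ₂Sq]; norm_num [b₂, b₄, b₆]) (by decide) (by decide) (by decide)

/-- `410850by3` = `[1,-1,0,10022058,1971881716]` (class `410850by`, (G-ord, `e = 2`) at `3`; twist `45650x3`, `a₃(V) = 2`, non-anomalous; even line
`φ = χ_{5}`): `x₀ = 1084`, `D = 5`, `s = 106240`, `Ψ₂Sq(x₀) = 56434688000` ⇒ `X3LineDatumThree W`. [folklore] -/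
theorem x3LineDatumThree_410850by3 : X3LineDatumThree (⟨1, -1, 0, 10022058, 1971881716⟩ : WeierstrassCurve ℚ) :=
  x3LineDatumThree_of_cert_of_delta _ (by norm_num [Δ, b₂, b₄, b₆, b₈]) 1084 106240 5
    (by simp only [Ψ₃, eval_add, eval_mul, eval_pow, eval_C, eval_X, eval_ofNat]; norm_num [b₂, b₄, b₆, b₈])
    (X2.CellACertN9.squarefree_of_nodup_primeFactorsList_natAbs (by norm_num) (by simp [Nat.primeFactorsList_ofNat])) (by norm_num)
    (by rw [KernelDisc.eval_Ψ₂Sq]; norm_num [b₂, b₄, b₆]) (by decide) (by decide) (by decide)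

/-- `410958c2` = `[1,-1,0,-1037310066,11634700437796]` (class `410958c`, (G-ord, `e = 2`) at `3`; twist `45662l2`, `a₃(V) = -1`, non-anomalous; even line
`φ = χ_{17}`): `x₀ = 30613`, `D = 17`, `s = 1419857`, `Ψ₂Sq(x₀) = 34271896307633` ⇒ `X3LineDatumThree W`. [folklore] -/
theorem x3LineDatumThree_410958c2 : X3LineDatumThree (⟨1, -1, 0, -1037310066, 11634700437796⟩ : WeierstrassCurve ℚ) :=
  x3LineDatumThree_of_cert_of_delta _ (by norm_num [Δ, b₂, b₄, b₆, b₈]) 30613 1419857 17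
    (by simp only [Ψ₃, eval_add, eval_mul, eval_pow, eval_C, eval_X, eval_ofNat]; norm_num [b₂, b₄, b₆, b₈])
    (X2.CellACertN9.squarefree_of_nodup_primeFactorsList_natAbs (by norm_num) (by simp [Nat.primeFactorsList_ofNat])) (by norm_num)
    (by rw [KernelDisc.eval_Ψ₂Sq]; norm_num [b₂, b₄, b₆]) (by decide) (by decide) (by decide)

/-- `411840em2` = `[0,0,0,85632,-29005792]` (class `411840em`, (G-ord, `e = 2`) at `3`; twist `45760w2`, `a₃(V) = 2`, non-anomalous; even line
`φ = χ_{2}`): `x₀ = 384`, `D = 2`, `s = 11000`, `Ψ₂Sq(x₀) = 242000000` ⇒ `X3LineDatumThree W`. [folklore] -/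
theorem x3LineDatumThree_411840em2 : X3LineDatumThree (⟨0, 0, 0, 85632, -29005792⟩ : WeierstrassCurve ℚ) :=
  x3LineDatumThree_of_cert_of_delta _ (by norm_num [Δ, b₂, b₄, b₆, b₈]) 384 11000 2
    (by simp only [Ψ₃, eval_add, eval_mul, eval_pow, eval_C, eval_X, eval_ofNat]; norm_num [b₂, b₄, b₆, b₈])
    Int.prime_two.squarefree (by norm_num)
    (by rw [KernelDisc.eval_Ψ₂Sq]; norm_num [b₂, b₄, b₆]) (by decide) (by decide) (by decide)

/-- `412650dr2` = `[1,-1,1,-31280,2137767]` (class `412650dr`, (G-ord, `e = 2`) at `3`; twist `45850b2`, `a₃(V) = -1`, non-anomalous; even line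
`φ = χ_{5}`): `x₀ = 94`, `D = 5`, `s = 131`, `Ψ₂Sq(x₀) = 85805` ⇒ `X3LineDatumThree W`. [folklore] -/
theorem x3LineDatumThree_412650dr2 : X3LineDatumThree (⟨1, -1, 1, -31280, 2137767⟩ : WeierstrassCurve ℚ) :=
  x3LineDatumThree_of_cert_of_delta _ (by norm_num [Δ, b₂, b₄, b₆, b₈]) 94 131 5
    (by simp only [Ψ₃, eval_add, eval_mul, eval_pow, eval_C, eval_X, eval_ofNat]; norm_num [b₂, b₄, b₆, b₈])
    (X2.CellACertN9.squarefree_of_nodup_primeFactorsList_natAbs (by norm_num) (by simp [Nat.primeFactorsList_ofNat])) (by norm_num)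
    (by rw [KernelDisc.eval_Ψ₂Sq]; norm_num [b₂, b₄, b₆]) (by decide) (by decide) (by decide)

/-- `414225bc2` = `[0,0,1,-99300,55524406]` (class `414225bc`, (G-ord, `e = 2`) at `3`; twist `46025c2`, `a₃(V) = 2`, non-anomalous; even line
`φ = χ_{5}`): `x₀ = 15`, `D = 5`, `s = 6575`, `Ψ₂Sq(x₀) = 216153125` ⇒ `X3LineDatumThree W`. [folklore] -/
theorem x3LineDatumThree_414225bc2 : X3LineDatumThree (⟨0, 0, 1, -99300, 55524406⟩ : WeierstrassCurve ℚ) :=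
  x3LineDatumThree_of_cert_of_delta _ (by norm_num [Δ, b₂, b₄, b₆, b₈]) 15 6575 5
    (by simp only [Ψ₃, eval_add, eval_mul, eval_pow, eval_C, eval_X, eval_ofNat]; norm_num [b₂, b₄, b₆, b₈])
    (X2.CellACertN9.squarefree_of_nodup_primeFactorsList_natAbs (by norm_num) (by simp [Nat.primeFactorsList_ofNat])) (by norm_num)
    (by rw [KernelDisc.eval_Ψ₂Sq]; norm_num [b₂, b₄, b₆]) (by decide) (by decide) (by decide)

/-- `417600ct2` = `[0,0,0,-3427500,2485150000]` (class `417600ct`, (G-ord, `e = 2`) at `3`; twist `46400w2`, `a₃(V) = -2` — ANOMALOUS (outside the end state as typed); even line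
`φ = χ_{10}`): `x₀ = 750`, `D = 10`, `s = 11600`, `Ψ₂Sq(x₀) = 1345600000` ⇒ `X3LineDatumThree W`. [folklore] -/
theorem x3LineDatumThree_417600ct2 : X3LineDatumThree (⟨0, 0, 0, -3427500, 2485150000⟩ : WeierstrassCurve ℚ) :=
  x3LineDatumThree_of_cert_of_delta _ (by norm_num [Δ, b₂, b₄, b₆, b₈]) 750 11600 10
    (by simp only [Ψ₃, eval_add, eval_mul, eval_pow, eval_C, eval_X, eval_ofNat]; norm_num [b₂, b₄, b₆, b₈])
    (X2.CellACertN9.squarefree_of_nodup_primeFactorsList_natAbs (by norm_num) (by simp [Nat.primeFactorsList_ofNat])) (by norm_num)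
    (by rw [KernelDisc.eval_Ψ₂Sq]; norm_num [b₂, b₄, b₆]) (by decide) (by decide) (by decide)

/-- `417600od2` = `[0,0,0,330900,-217390160]` (class `417600od`, (G-ord, `e = 2`) at `3`; twist `46400m2`, `a₃(V) = 1` — ANOMALOUS (outside the end state as typed); even line
`φ = χ_{10}`): `x₀ = 750`, `D = 10`, `s = 13456`, `Ψ₂Sq(x₀) = 1810639360` ⇒ `X3LineDatumThree W`. [folklore] -/
theorem x3LineDatumThree_417600od2 : X3LineDatumThree (⟨0, 0, 0, 330900, -217390160⟩ : WeierstrassCurve ℚ) :=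
  x3LineDatumThree_of_cert_of_delta _ (by norm_num [Δ, b₂, b₄, b₆, b₈]) 750 13456 10
    (by simp only [Ψ₃, eval_add, eval_mul, eval_pow, eval_C, eval_X, eval_ofNat]; norm_num [b₂, b₄, b₆, b₈])
    (X2.CellACertN9.squarefree_of_nodup_primeFactorsList_natAbs (by norm_num) (by simp [Nat.primeFactorsList_ofNat])) (by norm_num)
    (by rw [KernelDisc.eval_Ψ₂Sq]; norm_num [b₂, b₄, b₆]) (by decide) (by decide) (by decide)

/-- `417600pi2` = `[0,0,0,32100,2374000]` (class `417600pi`, (G-ord, `e = 2`) at `3`; twist `46400n2`, `a₃(V) = 1` — ANOMALOUS (outside the end state as typed); even line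
`φ = χ_{10}`): `x₀ = 30`, `D = 10`, `s = 1160`, `Ψ₂Sq(x₀) = 13456000` ⇒ `X3LineDatumThree W`. [folklore] -/
theorem x3LineDatumThree_417600pi2 : X3LineDatumThree (⟨0, 0, 0, 32100, 2374000⟩ : WeierstrassCurve ℚ) :=
  x3LineDatumThree_of_cert_of_delta _ (by norm_num [Δ, b₂, b₄, b₆, b₈]) 30 1160 10
    (by simp only [Ψ₃, eval_add, eval_mul, eval_pow, eval_C, eval_X, eval_ofNat]; norm_num [b₂, b₄, b₆, b₈])
    (X2.CellACertN9.squarefree_of_nodup_primeFactorsList_natAbs (by norm_num) (by simp [Nat.primeFactorsList_ofNat])) (by norm_num)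
    (by rw [KernelDisc.eval_Ψ₂Sq]; norm_num [b₂, b₄, b₆]) (by decide) (by decide) (by decide)

/-- `418050x2` = `[1,-1,0,-301561992,2013626756416]` (class `418050x`, (G-ord, `e = 2`) at `3`; twist `46450o2`, `a₃(V) = -1`, non-anomalous; even line
`φ = χ_{5}`): `x₀ = 11344`, `D = 5`, `s = 204800`, `Ψ₂Sq(x₀) = 209715200000` ⇒ `X3LineDatumThree W`. [folklore] -/
theorem x3LineDatumThree_418050x2 : X3LineDatumThree (⟨1, -1, 0, -301561992, 2013626756416⟩ : WeierstrassCurve ℚ) :=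
  x3LineDatumThree_of_cert_of_delta _ (by norm_num [Δ, b₂, b₄, b₆, b₈]) 11344 204800 5
    (by simp only [Ψ₃, eval_add, eval_mul, eval_pow, eval_C, eval_X, eval_ofNat]; norm_num [b₂, b₄, b₆, b₈])
    (X2.CellACertN9.squarefree_of_nodup_primeFactorsList_natAbs (by norm_num) (by simp [Nat.primeFactorsList_ofNat])) (by norm_num)
    (by rw [KernelDisc.eval_Ψ₂Sq]; norm_num [b₂, b₄, b₆]) (by decide) (by decide) (by decide)

/-- `418275bt2` = `[0,0,1,-143861250,-362626864844]` (class `418275bt`, (G-ord, `e = 2`) at `3`; twist `46475d2`, `a₃(V) = -1`, non-anomalous; even line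
`φ = χ_{65}`): `x₀ = 19500`, `D = 65`, `s = 511225`, `Ψ₂Sq(x₀) = 16987815040625` ⇒ `X3LineDatumThree W`. [folklore] -/
theorem x3LineDatumThree_418275bt2 : X3LineDatumThree (⟨0, 0, 1, -143861250, -362626864844⟩ : WeierstrassCurve ℚ) :=
  x3LineDatumThree_of_cert_of_delta _ (by norm_num [Δ, b₂, b₄, b₆, b₈]) 19500 511225 65
    (by simp only [Ψ₃, eval_add, eval_mul, eval_pow, eval_C, eval_X, eval_ofNat]; norm_num [b₂, b₄, b₆, b₈])
    (X2.CellACertN9.squarefree_of_nodup_primeFactorsList_natAbs (by norm_num) (by simp [Nat.primeFactorsList_ofNat])) (by norm_num)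
    (by rw [KernelDisc.eval_Ψ₂Sq]; norm_num [b₂, b₄, b₆]) (by decide) (by decide) (by decide)

/-- `418275bu2` = `[0,0,1,1698450,1065339031]` (class `418275bu`, (G-ord, `e = 2`) at `3`; twist `46475e2`, `a₃(V) = 2`, non-anomalous; even line
`φ = χ_{65}`): `x₀ = 195`, `D = 65`, `s = 9295`, `Ψ₂Sq(x₀) = 5615806625` ⇒ `X3LineDatumThree W`. [folklore] -/
theorem x3LineDatumThree_418275bu2 : X3LineDatumThree (⟨0, 0, 1, 1698450, 1065339031⟩ : WeierstrassCurve ℚ) :=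
  x3LineDatumThree_of_cert_of_delta _ (by norm_num [Δ, b₂, b₄, b₆, b₈]) 195 9295 65
    (by simp only [Ψ₃, eval_add, eval_mul, eval_pow, eval_C, eval_X, eval_ofNat]; norm_num [b₂, b₄, b₆, b₈])
    (X2.CellACertN9.squarefree_of_nodup_primeFactorsList_natAbs (by norm_num) (by simp [Nat.primeFactorsList_ofNat])) (by norm_num)
    (by rw [KernelDisc.eval_Ψ₂Sq]; norm_num [b₂, b₄, b₆]) (by decide) (by decide) (by decide)

/-- `418950jd2` = `[1,-1,1,-150170,22510527]` (class `418950jd`, (G-ord, `e = 2`) at `3`; twist `46550d2`, `a₃(V) = -1`, non-anomalous; even line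
`φ = χ_{5}`): `x₀ = 184`, `D = 5`, `s = 931`, `Ψ₂Sq(x₀) = 4333805` ⇒ `X3LineDatumThree W`. [folklore] -/
theorem x3LineDatumThree_418950jd2 : X3LineDatumThree (⟨1, -1, 1, -150170, 22510527⟩ : WeierstrassCurve ℚ) :=
  x3LineDatumThree_of_cert_of_delta _ (by norm_num [Δ, b₂, b₄, b₆, b₈]) 184 931 5
    (by simp only [Ψ₃, eval_add, eval_mul, eval_pow, eval_C, eval_X, eval_ofNat]; norm_num [b₂, b₄, b₆, b₈])
    (X2.CellACertN9.squarefree_of_nodup_primeFactorsList_natAbs (by norm_num) (by simp [Nat.primeFactorsList_ofNat])) (by norm_num)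
    (by rw [KernelDisc.eval_Ψ₂Sq]; norm_num [b₂, b₄, b₆]) (by decide) (by decide) (by decide)

/-- `418950rc2` = `[1,-1,1,-46724180,122699943447]` (class `418950rc`, (G-ord, `e = 2`) at `3`; twist `46550e2`, `a₃(V) = 2`, non-anomalous; even line
`φ = χ_{5}`): `x₀ = 4594`, `D = 5`, `s = 63175`, `Ψ₂Sq(x₀) = 19955403125` ⇒ `X3LineDatumThree W`. [folklore] -/
theorem x3LineDatumThree_418950rc2 : X3LineDatumThree (⟨1, -1, 1, -46724180, 122699943447⟩ : WeierstrassCurve ℚ) :=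
  x3LineDatumThree_of_cert_of_delta _ (by norm_num [Δ, b₂, b₄, b₆, b₈]) 4594 63175 5
    (by simp only [Ψ₃, eval_add, eval_mul, eval_pow, eval_C, eval_X, eval_ofNat]; norm_num [b₂, b₄, b₆, b₈])
    (X2.CellACertN9.squarefree_of_nodup_primeFactorsList_natAbs (by norm_num) (by simp [Nat.primeFactorsList_ofNat])) (by norm_num)
    (by rw [KernelDisc.eval_Ψ₂Sq]; norm_num [b₂, b₄, b₆]) (by decide) (by decide) (by decide)

/-- `423405h2` = `[0,0,1,-10274628,575212158]` (class `423405h`, (G-ord, `e = 2`) at `3`; twist `47045b2`, `a₃(V) = -2` — ANOMALOUS (outside the end state as typed); even line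
`φ = χ_{97}`): `x₀ = 4656`, `D = 97`, `s = 47045`, `Ψ₂Sq(x₀) = 214683506425` ⇒ `X3LineDatumThree W`. [folklore] -/
theorem x3LineDatumThree_423405h2 : X3LineDatumThree (⟨0, 0, 1, -10274628, 575212158⟩ : WeierstrassCurve ℚ) :=
  x3LineDatumThree_of_cert_of_delta _ (by norm_num [Δ, b₂, b₄, b₆, b₈]) 4656 47045 97
    (by simp only [Ψ₃, eval_add, eval_mul, eval_pow, eval_C, eval_X, eval_ofNat]; norm_num [b₂, b₄, b₆, b₈])
    (X2.CellACertN9.squarefree_of_nodup_primeFactorsList_natAbs (by norm_num) (by simp [Nat.primeFactorsList_ofNat])) (by norm_num)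
    (by rw [KernelDisc.eval_Ψ₂Sq]; norm_num [b₂, b₄, b₆]) (by decide) (by decide) (by decide)

/-- `423963d2` = `[0,0,1,-1917804,-1382620145]` (class `423963d`, (G-ord, `e = 2`) at `3`; twist `47107b2`, `a₃(V) = -1`, non-anomalous; even line
`φ = χ_{17}`): `x₀ = 2499`, `D = 17`, `s = 47107`, `Ψ₂Sq(x₀) = 37724180633` ⇒ `X3LineDatumThree W`. [folklore] -/
theorem x3LineDatumThree_423963d2 : X3LineDatumThree (⟨0, 0, 1, -1917804, -1382620145⟩ : WeierstrassCurve ℚ) :=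
  x3LineDatumThree_of_cert_of_delta _ (by norm_num [Δ, b₂, b₄, b₆, b₈]) 2499 47107 17
    (by simp only [Ψ₃, eval_add, eval_mul, eval_pow, eval_C, eval_X, eval_ofNat]; norm_num [b₂, b₄, b₆, b₈])
    (X2.CellACertN9.squarefree_of_nodup_primeFactorsList_natAbs (by norm_num) (by simp [Nat.primeFactorsList_ofNat])) (by norm_num)
    (by rw [KernelDisc.eval_Ψ₂Sq]; norm_num [b₂, b₄, b₆]) (by decide) (by decide) (by decide)

/-- `423963f2` = `[0,0,1,510,-45743]` (class `423963f`, (G-ord, `e = 2`) at `3`; twist `47107c2`, `a₃(V) = 2`, non-anomalous; even line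
`φ = χ_{17}`): `x₀ = 51`, `D = 17`, `s = 163`, `Ψ₂Sq(x₀) = 451673` ⇒ `X3LineDatumThree W`. [folklore] -/
theorem x3LineDatumThree_423963f2 : X3LineDatumThree (⟨0, 0, 1, 510, -45743⟩ : WeierstrassCurve ℚ) :=
  x3LineDatumThree_of_cert_of_delta _ (by norm_num [Δ, b₂, b₄, b₆, b₈]) 51 163 17
    (by simp only [Ψ₃, eval_add, eval_mul, eval_pow, eval_C, eval_X, eval_ofNat]; norm_num [b₂, b₄, b₆, b₈])
    (X2.CellACertN9.squarefree_of_nodup_primeFactorsList_natAbs (by norm_num) (by simp [Nat.primeFactorsList_ofNat])) (by norm_num)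
    (by rw [KernelDisc.eval_Ψ₂Sq]; norm_num [b₂, b₄, b₆]) (by decide) (by decide) (by decide)

/-- `424350be2` = `[1,-1,0,3358008,-6753723584]` (class `424350be`, (G-ord, `e = 2`) at `3`; twist `47150m2`, `a₃(V) = 2`, non-anomalous; even line
`φ = χ_{5}`): `x₀ = 2344`, `D = 5`, `s = 105800`, `Ψ₂Sq(x₀) = 55968200000` ⇒ `X3LineDatumThree W`. [folklore] -/
theorem x3LineDatumThree_424350be2 : X3LineDatumThree (⟨1, -1, 0, 3358008, -6753723584⟩ : WeierstrassCurve ℚ) :=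
  x3LineDatumThree_of_cert_of_delta _ (by norm_num [Δ, b₂, b₄, b₆, b₈]) 2344 105800 5
    (by simp only [Ψ₃, eval_add, eval_mul, eval_pow, eval_C, eval_X, eval_ofNat]; norm_num [b₂, b₄, b₆, b₈])
    (X2.CellACertN9.squarefree_of_nodup_primeFactorsList_natAbs (by norm_num) (by simp [Nat.primeFactorsList_ofNat])) (by norm_num)
    (by rw [KernelDisc.eval_Ψ₂Sq]; norm_num [b₂, b₄, b₆]) (by decide) (by decide) (by decide)

/-- `424350cg3` = `[1,-1,1,-6251630,3050401497]` (class `424350cg`, (G-ord, `e = 2`) at `3`; twist `47150c3`, `a₃(V) = 2`, non-anomalous; even line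
`φ = χ_{5}`): `x₀ = 3154`, `D = 5`, `s = 108445`, `Ψ₂Sq(x₀) = 58801590125` ⇒ `X3LineDatumThree W`. [folklore] -/
theorem x3LineDatumThree_424350cg3 : X3LineDatumThree (⟨1, -1, 1, -6251630, 3050401497⟩ : WeierstrassCurve ℚ) :=
  x3LineDatumThree_of_cert_of_delta _ (by norm_num [Δ, b₂, b₄, b₆, b₈]) 3154 108445 5
    (by simp only [Ψ₃, eval_add, eval_mul, eval_pow, eval_C, eval_X, eval_ofNat]; norm_num [b₂, b₄, b₆, b₈])
    (X2.CellACertN9.squarefree_of_nodup_primeFactorsList_natAbs (by norm_num) (by simp [Nat.primeFactorsList_ofNat])) (by norm_num)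
    (by rw [KernelDisc.eval_Ψ₂Sq]; norm_num [b₂, b₄, b₆]) (by decide) (by decide) (by decide)

/-- `424350dq2` = `[1,-1,1,-3503480,2661393147]` (class `424350dq`, (G-ord, `e = 2`) at `3`; twist `47150b2`, `a₃(V) = -1`, non-anomalous; even line
`φ = χ_{5}`): `x₀ = 634`, `D = 5`, `s = 23575`, `Ψ₂Sq(x₀) = 2778903125` ⇒ `X3LineDatumThree W`. [folklore] -/
theorem x3LineDatumThree_424350dq2 : X3LineDatumThree (⟨1, -1, 1, -3503480, 2661393147⟩ : WeierstrassCurve ℚ) :=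
  x3LineDatumThree_of_cert_of_delta _ (by norm_num [Δ, b₂, b₄, b₆, b₈]) 634 23575 5
    (by simp only [Ψ₃, eval_add, eval_mul, eval_pow, eval_C, eval_X, eval_ofNat]; norm_num [b₂, b₄, b₆, b₈])
    (X2.CellACertN9.squarefree_of_nodup_primeFactorsList_natAbs (by norm_num) (by simp [Nat.primeFactorsList_ofNat])) (by norm_num)
    (by rw [KernelDisc.eval_Ψ₂Sq]; norm_num [b₂, b₄, b₆]) (by decide) (by decide) (by decide)

/-- `424350t3` = `[1,-1,0,-36501192,84888265216]` (class `424350t`, (G-ord, `e = 2`) at `3`; twist `47150n3`, `a₃(V) = 2`, non-anomalous; even line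
`φ = χ_{5}`): `x₀ = 3604`, `D = 5`, `s = 10580`, `Ψ₂Sq(x₀) = 559682000` ⇒ `X3LineDatumThree W`. [folklore] -/
theorem x3LineDatumThree_424350t3 : X3LineDatumThree (⟨1, -1, 0, -36501192, 84888265216⟩ : WeierstrassCurve ℚ) :=
  x3LineDatumThree_of_cert_of_delta _ (by norm_num [Δ, b₂, b₄, b₆, b₈]) 3604 10580 5
    (by simp only [Ψ₃, eval_add, eval_mul, eval_pow, eval_C, eval_X, eval_ofNat]; norm_num [b₂, b₄, b₆, b₈])
    (X2.CellACertN9.squarefree_of_nodup_primeFactorsList_natAbs (by norm_num) (by simp [Nat.primeFactorsList_ofNat])) (by norm_num)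
    (by rw [KernelDisc.eval_Ψ₂Sq]; norm_num [b₂, b₄, b₆]) (by decide) (by decide) (by decide)

/-- `425664bc2` = `[0,0,0,-422220,129861488]` (class `425664bc`, (G-ord, `e = 2`) at `3`; twist `47296c2`, `a₃(V) = -1`, non-anomalous; even line
`φ = χ_{2}`): `x₀ = 150`, `D = 2`, `s = 11824`, `Ψ₂Sq(x₀) = 279613952` ⇒ `X3LineDatumThree W`. [folklore] -/
theorem x3LineDatumThree_425664bc2 : X3LineDatumThree (⟨0, 0, 0, -422220, 129861488⟩ : WeierstrassCurve ℚ) :=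
  x3LineDatumThree_of_cert_of_delta _ (by norm_num [Δ, b₂, b₄, b₆, b₈]) 150 11824 2
    (by simp only [Ψ₃, eval_add, eval_mul, eval_pow, eval_C, eval_X, eval_ofNat]; norm_num [b₂, b₄, b₆, b₈])
    Int.prime_two.squarefree (by norm_num)
    (by rw [KernelDisc.eval_Ψ₂Sq]; norm_num [b₂, b₄, b₆]) (by decide) (by decide) (by decide)

/-- `425700bh2` = `[0,0,0,-67125,403625]` (class `425700bh`, (G-ord, `e = 2`) at `3`; twist `47300d2`, `a₃(V) = 2`, non-anomalous; even line
`φ = χ_{5}`): `x₀ = 375`, `D = 5`, `s = 4730`, `Ψ₂Sq(x₀) = 111864500` ⇒ `X3LineDatumThree W`. [folklore] -/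
theorem x3LineDatumThree_425700bh2 : X3LineDatumThree (⟨0, 0, 0, -67125, 403625⟩ : WeierstrassCurve ℚ) :=
  x3LineDatumThree_of_cert_of_delta _ (by norm_num [Δ, b₂, b₄, b₆, b₈]) 375 4730 5
    (by simp only [Ψ₃, eval_add, eval_mul, eval_pow, eval_C, eval_X, eval_ofNat]; norm_num [b₂, b₄, b₆, b₈])
    (X2.CellACertN9.squarefree_of_nodup_primeFactorsList_natAbs (by norm_num) (by simp [Nat.primeFactorsList_ofNat])) (by norm_num)
    (by rw [KernelDisc.eval_Ψ₂Sq]; norm_num [b₂, b₄, b₆]) (by decide) (by decide) (by decide)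

/-- `425700s2` = `[0,0,0,-2579113200,-44465426831500]` (class `425700s`, (G-ord, `e = 2`) at `3`; twist `47300c2`, `a₃(V) = -1`, non-anomalous; even line
`φ = χ_{5}`): `x₀ = 86640`, `D = 5`, `s = 17491540`, `Ψ₂Sq(x₀) = 1529769857858000` ⇒ `X3LineDatumThree W`. [folklore] -/
theorem x3LineDatumThree_425700s2 : X3LineDatumThree (⟨0, 0, 0, -2579113200, -44465426831500⟩ : WeierstrassCurve ℚ) :=
  x3LineDatumThree_of_cert_of_delta _ (by norm_num [Δ, b₂, b₄, b₆, b₈]) 86640 17491540 5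
    (by simp only [Ψ₃, eval_add, eval_mul, eval_pow, eval_C, eval_X, eval_ofNat]; norm_num [b₂, b₄, b₆, b₈])
    (X2.CellACertN9.squarefree_of_nodup_primeFactorsList_natAbs (by norm_num) (by simp [Nat.primeFactorsList_ofNat])) (by norm_num)
    (by rw [KernelDisc.eval_Ψ₂Sq]; norm_num [b₂, b₄, b₆]) (by decide) (by decide) (by decide)

/-- `427050bn2` = `[1,-1,0,-3169899567,-66930796245659]` (class `427050bn`, (G-ord, `e = 2`) at `3`; twist `47450r2`, `a₃(V) = -1`, non-anomalous; even line
`φ = χ_{5}`): `x₀ = 97204`, `D = 5`, `s = 20849530`, `Ψ₂Sq(x₀) = 2173514506104500` ⇒ `X3LineDatumThree W`. [folklore] -/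
theorem x3LineDatumThree_427050bn2 : X3LineDatumThree (⟨1, -1, 0, -3169899567, -66930796245659⟩ : WeierstrassCurve ℚ) :=
  x3LineDatumThree_of_cert_of_delta _ (by norm_num [Δ, b₂, b₄, b₆, b₈]) 97204 20849530 5
    (by simp only [Ψ₃, eval_add, eval_mul, eval_pow, eval_C, eval_X, eval_ofNat]; norm_num [b₂, b₄, b₆, b₈])
    (X2.CellACertN9.squarefree_of_nodup_primeFactorsList_natAbs (by norm_num) (by simp [Nat.primeFactorsList_ofNat])) (by norm_num)
    (by rw [KernelDisc.eval_Ψ₂Sq]; norm_num [b₂, b₄, b₆]) (by decide) (by decide) (by decide)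

/-- `427050p3` = `[1,-1,0,-98867817,-311994660659]` (class `427050p`, (G-ord, `e = 2`) at `3`; twist `47450t3`, `a₃(V) = 2`, non-anomalous; even line
`φ = χ_{5}`): `x₀ = 16834`, `D = 5`, `s = 1495040`, `Ψ₂Sq(x₀) = 11175723008000` ⇒ `X3LineDatumThree W`. [folklore] -/
theorem x3LineDatumThree_427050p3 : X3LineDatumThree (⟨1, -1, 0, -98867817, -311994660659⟩ : WeierstrassCurve ℚ) :=
  x3LineDatumThree_of_cert_of_delta _ (by norm_num [Δ, b₂, b₄, b₆, b₈]) 16834 1495040 5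
    (by simp only [Ψ₃, eval_add, eval_mul, eval_pow, eval_C, eval_X, eval_ofNat]; norm_num [b₂, b₄, b₆, b₈])
    (X2.CellACertN9.squarefree_of_nodup_primeFactorsList_natAbs (by norm_num) (by simp [Nat.primeFactorsList_ofNat])) (by norm_num)
    (by rw [KernelDisc.eval_Ψ₂Sq]; norm_num [b₂, b₄, b₆]) (by decide) (by decide) (by decide)

/-- `428850j2` = `[1,-1,0,-11265326442,460221519545716]` (class `428850j`, (G-ord, `e = 2`) at `3`; twist `47650k2`, `a₃(V) = 2`, non-anomalous; even line
`φ = χ_{5}`): `x₀ = 60484`, `D = 5`, `s = 304960`, `Ψ₂Sq(x₀) = 465003008000` ⇒ `X3LineDatumThree W`. [folklore] -/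
theorem x3LineDatumThree_428850j2 : X3LineDatumThree (⟨1, -1, 0, -11265326442, 460221519545716⟩ : WeierstrassCurve ℚ) :=
  x3LineDatumThree_of_cert_of_delta _ (by norm_num [Δ, b₂, b₄, b₆, b₈]) 60484 304960 5
    (by simp only [Ψ₃, eval_add, eval_mul, eval_pow, eval_C, eval_X, eval_ofNat]; norm_num [b₂, b₄, b₆, b₈])
    (X2.CellACertN9.squarefree_of_nodup_primeFactorsList_natAbs (by norm_num) (by simp [Nat.primeFactorsList_ofNat])) (by norm_num)
    (by rw [KernelDisc.eval_Ψ₂Sq]; norm_num [b₂, b₄, b₆]) (by decide) (by decide) (by decide)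

/-- `429777l2` = `[0,0,1,-17629284,28488842185]` (class `429777l`, (G-ord, `e = 2`) at `3`; twist `47753e2`, `a₃(V) = -1`, non-anomalous; even line
`φ = χ_{53}`): `x₀ = 2544`, `D = 53`, `s = 2809`, `Ψ₂Sq(x₀) = 418195493` ⇒ `X3LineDatumThree W`. [folklore] -/
theorem x3LineDatumThree_429777l2 : X3LineDatumThree (⟨0, 0, 1, -17629284, 28488842185⟩ : WeierstrassCurve ℚ) :=
  x3LineDatumThree_of_cert_of_delta _ (by norm_num [Δ, b₂, b₄, b₆, b₈]) 2544 2809 53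
    (by simp only [Ψ₃, eval_add, eval_mul, eval_pow, eval_C, eval_X, eval_ofNat]; norm_num [b₂, b₄, b₆, b₈])
    (X2.CellACertN9.squarefree_of_nodup_primeFactorsList_natAbs (by norm_num) (by simp [Nat.primeFactorsList_ofNat])) (by norm_num)
    (by rw [KernelDisc.eval_Ψ₂Sq]; norm_num [b₂, b₄, b₆]) (by decide) (by decide) (by decide)

/-- `430416ck2` = `[0,0,0,-19760475,-29728625654]` (class `430416ck`, (G-ord, `e = 2`) at `3`; twist `47824h2`, `a₃(V) = 1` — ANOMALOUS (outside the end state as typed); even line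
`φ = χ_{7}`): `x₀ = 7581`, `D = 7`, `s = 382592`, `Ψ₂Sq(x₀) = 1024636469248` ⇒ `X3LineDatumThree W`. [folklore] -/
theorem x3LineDatumThree_430416ck2 : X3LineDatumThree (⟨0, 0, 0, -19760475, -29728625654⟩ : WeierstrassCurve ℚ) :=
  x3LineDatumThree_of_cert_of_delta _ (by norm_num [Δ, b₂, b₄, b₆, b₈]) 7581 382592 7
    (by simp only [Ψ₃, eval_add, eval_mul, eval_pow, eval_C, eval_X, eval_ofNat]; norm_num [b₂, b₄, b₆, b₈])
    (X2.CellACertN9.squarefree_of_nodup_primeFactorsList_natAbs (by norm_num) (by simp [Nat.primeFactorsList_ofNat])) (by norm_num)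
    (by rw [KernelDisc.eval_Ψ₂Sq]; norm_num [b₂, b₄, b₆]) (by decide) (by decide) (by decide)

/-- `430416ct2` = `[0,0,0,8925,220066]` (class `430416ct`, (G-ord, `e = 2`) at `3`; twist `47824g2`, `a₃(V) = 1` — ANOMALOUS (outside the end state as typed); even line
`φ = χ_{7}`): `x₀ = 21`, `D = 7`, `s = 488`, `Ψ₂Sq(x₀) = 1667008` ⇒ `X3LineDatumThree W`. [folklore] -/
theorem x3LineDatumThree_430416ct2 : X3LineDatumThree (⟨0, 0, 0, 8925, 220066⟩ : WeierstrassCurve ℚ) :=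
  x3LineDatumThree_of_cert_of_delta _ (by norm_num [Δ, b₂, b₄, b₆, b₈]) 21 488 7
    (by simp only [Ψ₃, eval_add, eval_mul, eval_pow, eval_C, eval_X, eval_ofNat]; norm_num [b₂, b₄, b₆, b₈])
    (X2.CellACertN9.squarefree_of_nodup_primeFactorsList_natAbs (by norm_num) (by simp [Nat.primeFactorsList_ofNat])) (by norm_num)
    (by rw [KernelDisc.eval_Ψ₂Sq]; norm_num [b₂, b₄, b₆]) (by decide) (by decide) (by decide)

/-- `430416cw2` = `[0,0,0,-647535,200357962]` (class `430416cw`, (G-ord, `e = 2`) at `3`; twist `47824i2`, `a₃(V) = 1` — ANOMALOUS (outside the end state as typed); even line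
`φ = χ_{7}`): `x₀ = 525`, `D = 7`, `s = 1708`, `Ψ₂Sq(x₀) = 20420848` ⇒ `X3LineDatumThree W`. [folklore] -/
theorem x3LineDatumThree_430416cw2 : X3LineDatumThree (⟨0, 0, 0, -647535, 200357962⟩ : WeierstrassCurve ℚ) :=
  x3LineDatumThree_of_cert_of_delta _ (by norm_num [Δ, b₂, b₄, b₆, b₈]) 525 1708 7
    (by simp only [Ψ₃, eval_add, eval_mul, eval_pow, eval_C, eval_X, eval_ofNat]; norm_num [b₂, b₄, b₆, b₈])
    (X2.CellACertN9.squarefree_of_nodup_primeFactorsList_natAbs (by norm_num) (by simp [Nat.primeFactorsList_ofNat])) (by norm_num)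
    (by rw [KernelDisc.eval_Ψ₂Sq]; norm_num [b₂, b₄, b₆]) (by decide) (by decide) (by decide)

/-- `430416de2` = `[0,0,0,-482160,129177916]` (class `430416de`, (G-ord, `e = 2`) at `3`; twist `47824n2`, `a₃(V) = -2` — ANOMALOUS (outside the end state as typed); even line
`φ = χ_{7}`): `x₀ = 336`, `D = 7`, `s = 1708`, `Ψ₂Sq(x₀) = 20420848` ⇒ `X3LineDatumThree W`. [folklore] -/
theorem x3LineDatumThree_430416de2 : X3LineDatumThree (⟨0, 0, 0, -482160, 129177916⟩ : WeierstrassCurve ℚ) :=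
  x3LineDatumThree_of_cert_of_delta _ (by norm_num [Δ, b₂, b₄, b₆, b₈]) 336 1708 7
    (by simp only [Ψ₃, eval_add, eval_mul, eval_pow, eval_C, eval_X, eval_ofNat]; norm_num [b₂, b₄, b₆, b₈])
    (X2.CellACertN9.squarefree_of_nodup_primeFactorsList_natAbs (by norm_num) (by simp [Nat.primeFactorsList_ofNat])) (by norm_num)
    (by rw [KernelDisc.eval_Ψ₂Sq]; norm_num [b₂, b₄, b₆]) (by decide) (by decide) (by decide)

/-- `431766bu2` = `[1,-1,1,1039045,-3579045717]` (class `431766bu`, (G-ord, `e = 2`) at `3`; twist `47974c2`, `a₃(V) = -1`, non-anomalous; even line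
`φ = χ_{17}`): `x₀ = 2155`, `D = 17`, `s = 45152`, `Ψ₂Sq(x₀) = 34657952768` ⇒ `X3LineDatumThree W`. [folklore] -/
theorem x3LineDatumThree_431766bu2 : X3LineDatumThree (⟨1, -1, 1, 1039045, -3579045717⟩ : WeierstrassCurve ℚ) :=
  x3LineDatumThree_of_cert_of_delta _ (by norm_num [Δ, b₂, b₄, b₆, b₈]) 2155 45152 17
    (by simp only [Ψ₃, eval_add, eval_mul, eval_pow, eval_C, eval_X, eval_ofNat]; norm_num [b₂, b₄, b₆, b₈])
    (X2.CellACertN9.squarefree_of_nodup_primeFactorsList_natAbs (by norm_num) (by simp [Nat.primeFactorsList_ofNat])) (by norm_num)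
    (by rw [KernelDisc.eval_Ψ₂Sq]; norm_num [b₂, b₄, b₆]) (by decide) (by decide) (by decide)

/-- `432450cd2` = `[1,-1,0,-10361682,9455260756]` (class `432450cd`, (G-ord, `e = 2`) at `3`; twist `48050q2`, `a₃(V) = 2`, non-anomalous; even line
`φ = χ_{5}`): `x₀ = 3604`, `D = 5`, `s = 123008`, `Ψ₂Sq(x₀) = 75654840320` ⇒ `X3LineDatumThree W`. [folklore] -/
theorem x3LineDatumThree_432450cd2 : X3LineDatumThree (⟨1, -1, 0, -10361682, 9455260756⟩ : WeierstrassCurve ℚ) :=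
  x3LineDatumThree_of_cert_of_delta _ (by norm_num [Δ, b₂, b₄, b₆, b₈]) 3604 123008 5
    (by simp only [Ψ₃, eval_add, eval_mul, eval_pow, eval_C, eval_X, eval_ofNat]; norm_num [b₂, b₄, b₆, b₈])
    (X2.CellACertN9.squarefree_of_nodup_primeFactorsList_natAbs (by norm_num) (by simp [Nat.primeFactorsList_ofNat])) (by norm_num)
    (by rw [KernelDisc.eval_Ψ₂Sq]; norm_num [b₂, b₄, b₆]) (by decide) (by decide) (by decide)

/-- `434880ea2` = `[0,0,0,12768,409376]` (class `434880ea`, (G-ord, `e = 2`) at `3`; twist `48320k2`, `a₃(V) = -1`, non-anomalous; even line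
`φ = χ_{2}`): `x₀ = 24`, `D = 2`, `s = 1208`, `Ψ₂Sq(x₀) = 2918528` ⇒ `X3LineDatumThree W`. [folklore] -/
theorem x3LineDatumThree_434880ea2 : X3LineDatumThree (⟨0, 0, 0, 12768, 409376⟩ : WeierstrassCurve ℚ) :=
  x3LineDatumThree_of_cert_of_delta _ (by norm_num [Δ, b₂, b₄, b₆, b₈]) 24 1208 2
    (by simp only [Ψ₃, eval_add, eval_mul, eval_pow, eval_C, eval_X, eval_ofNat]; norm_num [b₂, b₄, b₆, b₈])
    Int.prime_two.squarefree (by norm_num)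
    (by rw [KernelDisc.eval_Ψ₂Sq]; norm_num [b₂, b₄, b₆]) (by decide) (by decide) (by decide)

end Summit.BirchSwinnertonDyer.Rank1Residual.Additive.X3ThreeLineDatumRecords
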